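import Mathlib
import HarnessLib
import Summits.NavierStokesRegularity.NavierStokesRegularity.Theorems.PoloidalWindowDoorPoloidalWindowRigidityWindow
import Summits.NavierStokesRegularity.NavierStokesRegularity.Theorems.PoloidalWindowDoorPoloidalWindowRigidityClassSpaceTimeRates
import Summits.NavierStokesRegularity.NavierStokesRegularity.Theorems.PoloidalWindowDoorLrcModEntireTwistingTHBranchLaw

/-!
# Item `LrcModEntire` (stmt-NavierStokesRegularity-20428), skeleton twist_split v6, CLASS road to `stub_twistingTHGerm` —
# (BRANCH), second half, part 1: the VALUE of `v₂` along a `C²` branch of plane-critical points — regularity, derivative formulas, Type-I rates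

Cell ns-regularity-ideate, seat ns-k2-port-2 g4 (kernel-port lineage; `--supports stmt-NavierStokesRegularity-20428 --as helper`; brick (F5b), sequel of
`…TwistingTHBranchLaw`, which it imports).  Setting: a class profile `v` (Type-I, continuous, Oseen-mild, div-free) and ONE branch `X : (t,z) ↦ ℝ³`, `C²` on the
open slab `{t<0} × ℝ`, lying on the plane of its height (`X(t,z)₂ = z`) and HORIZONTALLY CRITICAL for `v₂` (`∂₀v₂ = ∂₁v₂ = 0` at `X(t,z)` — e.g. a
plane maximiser or minimiser, `…PlaneOscillation.fderiv_horiz_eq_zero_of_planeMax/Min`).  The branch value `Θ(t,z) := v₂(t, X(t,z))`: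

* `contDiffOn_branchValue` — `Θ ∈ C²` on the open slab (joint smoothness of the class ∘ the `C²` graph map);
* `hasDerivAt_branchValue_time` — **`∂ₜΘ(t,z) = ∂ₜv₂(t, X(t,z))`** (the branch velocity drops out: it is horizontal, and `∇ₕv₂ = 0` at `X`);
* `hasDerivAt_branchValue_height` — **`∂_zΘ(t,z) = ∂₂v₂(t, X(t,z))`** (same mechanism, `∂_zX₂ = 1`);
* `deriv_deriv_branchValue_height` — `∂_zzΘ(t,z) = D(∂₂v₂)(t,X)[∂_zX]`;
* `branchValue_rates` — the Type-I dictionary: `(−t)√(−t)|∂ₜΘ| ≤ K`, `(−t)|∂_zΘ| ≤ K`, `(−t)√(−t)|∂_zzΘ| ≤ K·‖∂_zX‖`, one `K ≥ 0` per profile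
  (`…ClassSpaceTimeRates`: `∂ₜv`, `Dv`, `D²v` rates).

WHAT THIS IS NOT: not a claim about Navier–Stokes regularity and not the stub — calculus (bears_on LADDER-NS N0, item 20428 / crux 19708; both OPEN).
-/

noncomputable section

-- the summit and its single sub-problem share the name (CONVENTIONS §1), as in every Theorems file
set_option linter.dupNamespace false

namespace Summit.NavierStokesRegularity.NavierStokesRegularity.Theorems.PoloidalWindowDoorLrcModEntireTwistingTHBranchValues

open Set Function Filter Topology
open scoped RealInnerProductSpace InnerProductSpace
open Literature.Analysis Literature.Analysis.FluidPDE
open Summit.NavierStokesRegularity.NavierStokesRegularity.Theorems.PoloidalWindowDoorPoloidalWindowRigidityWindow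
open Summit.NavierStokesRegularity.NavierStokesRegularity.Theorems.PoloidalWindowDoorPoloidalWindowRigidityClassSpaceTimeRates
open Summit.NavierStokesRegularity.NavierStokesRegularity.Theorems.PoloidalWindowDoorLrcModEntireTwistingTHPlaneOscillation
open Summit.NavierStokesRegularity.NavierStokesRegularity.Theorems.PoloidalWindowDoorLrcModEntireTwistingTHBranchLaw (slab_mem_nhds)

/-! ### Generic calculus helpers -/

/-- The open backward slab (space-time) is a neighbourhood of each of its points. -/
theorem slabE_mem_nhds {t : ℝ} (ht : t < 0) (x : EuclideanSpace ℝ (Fin 3)) :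
    Iio (0 : ℝ) ×ˢ (univ : Set (EuclideanSpace ℝ (Fin 3))) ∈ 𝓝 (t, x) :=
  prod_mem_nhds (Iio_mem_nhds ht) univ_mem

/-- The height coordinate of a derivative is the derivative of the height coordinate (curves in `ℝ³`). -/
theorem hasDerivAt_apply_two {γ : ℝ → EuclideanSpace ℝ (Fin 3)} {γ' : EuclideanSpace ℝ (Fin 3)} {s : ℝ}
    (h : HasDerivAt γ γ' s) : HasDerivAt (fun s => γ s 2) (γ' 2) s :=
  (EuclideanSpace.proj (𝕜 := ℝ) (2 : Fin 3)).hasFDerivAt.comp_hasDerivAt s h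

/-- `D(x ↦ Df(x)u)(y)h = D²f(y)[h,u]` for a `C²` vector field (Hessian spelling dictionary). -/
theorem fderiv_fderiv_apply_eq_iteratedFDeriv_two {f : EuclideanSpace ℝ (Fin 3) → EuclideanSpace ℝ (Fin 3)} (hf : ContDiff ℝ 2 f)
    (u y h : EuclideanSpace ℝ (Fin 3)) :
    fderiv ℝ (fun y => fderiv ℝ f y u) y h = iteratedFDeriv ℝ 2 f y ![h, u] := by
  have hd : DifferentiableAt ℝ (fderiv ℝ f) y :=
    ((hf.fderiv_right (m := 1) le_rfl).differentiable one_ne_zero) y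
  rw [iteratedFDeriv_two_apply, fderiv_clm_apply hd (differentiableAt_const _)]
  simp

/-! ### The class setting: one branch of plane-critical points -/

section Class

variable {C : ℝ} {v : ℝ → EuclideanSpace ℝ (Fin 3) → EuclideanSpace ℝ (Fin 3)}
variable (hrate : HasTypeITimeDecay C v) (hcont : ContinuousOn (uncurry v) (Iio (0 : ℝ) ×ˢ univ))
  (hmild : ∀ s t : ℝ, s < t → t < 0 → ∀ x,
    v t x = UnboundedOperators.heatExtension (v s) (t - s) x - oseenDuhamel 1 s v v t x)
  (hdiv : ∀ t < 0, VectorCalculus.IsDivFree (v t))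
  {X : ℝ → ℝ → EuclideanSpace ℝ (Fin 3)}
  (hX2 : ∀ t < 0, ∀ z, X t z 2 = z)
  (hXC : ContDiffOn ℝ 2 (uncurry X) (Iio (0 : ℝ) ×ˢ univ))
  (hcrit : ∀ t < 0, ∀ z, ∀ b : Fin 3, b ≠ 2 →
    fderiv ℝ (fun y => v t y 2) (X t z) (EuclideanSpace.single b 1) = 0)

include hrate hcont hmild hdiv

/-- The vertical velocity as a function on space-time, `V₂(p) = v₂(p.1, p.2)`, is `C^∞` on the open slab. -/
theorem contDiffOn_V2 : ContDiffOn ℝ 2 (fun p : ℝ × EuclideanSpace ℝ (Fin 3) => uncurry v p 2) (Iio (0 : ℝ) ×ˢ univ) := by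
  have hA := (isTypeIAncientMild_of_class hrate hcont hmild hdiv).contDiffOn
  have h2 : ContDiffOn ℝ 2 (uncurry v) (Iio (0 : ℝ) ×ˢ univ) := hA.of_le (by norm_cast)
  exact ((EuclideanSpace.proj (𝕜 := ℝ) (2 : Fin 3)).contDiff.comp_contDiffOn h2)

/-- At interior points `V₂` has a Fréchet derivative `L`, whose time slice is the time derivative of `s ↦ v₂(s,x)` and whose space slice is the
space derivative of `y ↦ v₂(t,y)`. -/
theorem hasFDerivAt_V2 {t : ℝ} (ht : t < 0) (x : EuclideanSpace ℝ (Fin 3)) :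
    ∃ L : ℝ × EuclideanSpace ℝ (Fin 3) →L[ℝ] ℝ,
      HasFDerivAt (fun p : ℝ × EuclideanSpace ℝ (Fin 3) => uncurry v p 2) L (t, x) ∧
      HasDerivAt (fun s => v s x 2) (L (1, 0)) t ∧
      HasFDerivAt (fun y => v t y 2) (L.comp (ContinuousLinearMap.inr ℝ ℝ (EuclideanSpace ℝ (Fin 3)))) x := by
  have hd : DifferentiableAt ℝ (fun p : ℝ × EuclideanSpace ℝ (Fin 3) => uncurry v p 2) (t, x) :=
    ((contDiffOn_V2 hrate hcont hmild hdiv).differentiableOn (by norm_num)).differentiableAt (slabE_mem_nhds ht x)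
  refine ⟨fderiv ℝ (fun p : ℝ × EuclideanSpace ℝ (Fin 3) => uncurry v p 2) (t, x), hd.hasFDerivAt, ?_, ?_⟩
  · have h := (hd.hasFDerivAt.comp t (hasFDerivAt_prodMk_left t x)).hasDerivAt
    have e : ((fderiv ℝ (fun p : ℝ × EuclideanSpace ℝ (Fin 3) => uncurry v p 2) (t, x)).comp
        (ContinuousLinearMap.inl ℝ ℝ (EuclideanSpace ℝ (Fin 3)))) 1 =
        fderiv ℝ (fun p : ℝ × EuclideanSpace ℝ (Fin 3) => uncurry v p 2) (t, x) (1, 0) := by simp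
    rw [e] at h
    exact h
  · exact hd.hasFDerivAt.comp x (hasFDerivAt_prodMk_right t x)

include hX2 hXC

omit hrate hcont hmild hdiv hX2 in
/-- The graph map `(t,z) ↦ (t, X(t,z))` is `C²` on the slab and maps it into the space-time slab. -/
theorem contDiffOn_graph : ContDiffOn ℝ 2 (fun p : ℝ × ℝ => ((p.1, uncurry X p) : ℝ × EuclideanSpace ℝ (Fin 3))) (Iio (0 : ℝ) ×ˢ univ) :=
  contDiffOn_fst.prodMk hXC

omit hX2 in
/-- **The branch value `Θ(t,z) = v₂(t,X(t,z))` is `C²` on the open slab.** -/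
theorem contDiffOn_branchValue : ContDiffOn ℝ 2 (uncurry fun t z => v t (X t z) 2) (Iio (0 : ℝ) ×ˢ univ) := by
  have h := (contDiffOn_V2 hrate hcont hmild hdiv).comp (contDiffOn_graph hXC)
    (fun p hp => mk_mem_prod (mem_prod.1 hp).1 (mem_univ _))
  exact h

omit hrate hcont hmild hdiv in
/-- The time line `s ↦ X(s,z)` is differentiable at interior times, with HORIZONTAL velocity. -/
theorem hasDerivAt_branch_time {t : ℝ} (ht : t < 0) (z : ℝ) :
    HasDerivAt (fun s => X s z) (deriv (fun s => X s z) t) t ∧ (deriv (fun s => X s z) t) 2 = 0 := by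
  have h1 : DifferentiableAt ℝ (uncurry X) (t, z) := (hXC.differentiableOn (by norm_num)).differentiableAt (slab_mem_nhds ht z)
  have h2 : DifferentiableAt ℝ (fun s => X s z) t := by
    have h := h1.comp t ((differentiableAt_id (𝕜 := ℝ)).prodMk (differentiableAt_const z))
    simpa [Function.comp_def] using h
  refine ⟨h2.hasDerivAt, ?_⟩
  have h3 := hasDerivAt_apply_two h2.hasDerivAt
  -- `s ↦ X(s,z)₂ = z` near `t`
  have hconst : (fun s => X s z 2) =ᶠ[𝓝 t] fun _ => z := by
    filter_upwards [Iio_mem_nhds ht] with s hs using hX2 s hs z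
  have h4 : HasDerivAt (fun s => X s z 2) 0 t := (hasDerivAt_const t z).congr_of_eventuallyEq hconst
  exact h3.unique h4

omit hrate hcont hmild hdiv in
/-- The height line `z ↦ X(t,z)` is differentiable, with velocity of UNIT height component. -/
theorem hasDerivAt_branch_height {t : ℝ} (ht : t < 0) (z : ℝ) :
    HasDerivAt (X t) (deriv (X t) z) z ∧ (deriv (X t) z) 2 = 1 := by
  have h1 : DifferentiableAt ℝ (uncurry X) (t, z) := (hXC.differentiableOn (by norm_num)).differentiableAt (slab_mem_nhds ht z)
  have h2 : DifferentiableAt ℝ (X t) z := by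
    have h := h1.comp z ((differentiableAt_const t).prodMk (differentiableAt_id (𝕜 := ℝ)))
    simpa [Function.comp_def] using h
  refine ⟨h2.hasDerivAt, ?_⟩
  have h3 := hasDerivAt_apply_two h2.hasDerivAt
  have hid : (fun z' => X t z' 2) = fun z' => z' := funext fun z' => hX2 t ht z'
  have h4 : HasDerivAt (fun z' => X t z' 2) 1 z := by rw [hid]; exact hasDerivAt_id z
  exact h3.unique h4

include hcrit

/-- **`∂ₜΘ = ∂ₜv₂` along the branch**: `s ↦ v₂(s, X(s,z))` has derivative `∂ₜv₂(t, X(t,z))` (`= deriv (s ↦ v₂(s, X(t,z))) t`) at `t`. -/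
theorem hasDerivAt_branchValue_time {t : ℝ} (ht : t < 0) (z : ℝ) :
    HasDerivAt (fun s => v s (X s z) 2) (deriv (fun s => v s (X t z) 2) t) t := by
  obtain ⟨L, hL, hLt, hLx⟩ := hasFDerivAt_V2 hrate hcont hmild hdiv ht (X t z)
  obtain ⟨hXt, hXt2⟩ := hasDerivAt_branch_time hX2 hXC ht z
  -- the curve `s ↦ (s, X(s,z))` and the chain rule
  have hγ : HasDerivAt (fun s => ((s, X s z) : ℝ × EuclideanSpace ℝ (Fin 3))) (1, deriv (fun s => X s z) t) t :=
    (hasDerivAt_id t).prodMk hXt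
  have hcomp := hL.comp_hasDerivAt t hγ
  -- split `L(1, Ẋ) = L(1,0) + L(0,Ẋ)` and kill the space part: `L(0,Ẋ) = Dv₂(X)Ẋ = Ẋ₂ ∂₂v₂ = 0`
  have hsplit : L (1, deriv (fun s => X s z) t) = L (1, 0) + L (0, deriv (fun s => X s z) t) := by
    rw [← map_add]; congr 1; simp
  have hspace : L (0, deriv (fun s => X s z) t) = fderiv ℝ (fun y => v t y 2) (X t z) (deriv (fun s => X s z) t) := by
    rw [hLx.fderiv]; simp
  have hzero : fderiv ℝ (fun y => v t y 2) (X t z) (deriv (fun s => X s z) t) = 0 := by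
    rw [fderiv_apply_of_horiz_eq_zero (hcrit t ht z 0 (by decide)) (hcrit t ht z 1 (by decide)), hXt2, zero_mul]
  rw [hsplit, hspace, hzero, add_zero, ← hLt.deriv] at hcomp
  exact hcomp

/-- **`∂_zΘ = ∂₂v₂` along the branch**: `z ↦ v₂(t, X(t,z))` has derivative `∂₂v₂(t, X(t,z))` at `z`. -/
theorem hasDerivAt_branchValue_height {t : ℝ} (ht : t < 0) (z : ℝ) :
    HasDerivAt (fun z' => v t (X t z') 2) (fderiv ℝ (fun y => v t y 2) (X t z) (EuclideanSpace.single 2 1)) z := by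
  obtain ⟨L, -, -, hLx⟩ := hasFDerivAt_V2 hrate hcont hmild hdiv ht (X t z)
  obtain ⟨hXz, hXz2⟩ := hasDerivAt_branch_height hX2 hXC ht z
  have hcomp : HasDerivAt (fun z' => v t (X t z') 2) (fderiv ℝ (fun y => v t y 2) (X t z) (deriv (X t) z)) z := by
    have h := hLx.comp_hasDerivAt z hXz
    rw [hLx.fderiv]
    exact h
  rw [fderiv_apply_of_horiz_eq_zero (hcrit t ht z 0 (by decide)) (hcrit t ht z 1 (by decide)), hXz2, one_mul] at hcomp
  exact hcomp

/-- **`∂_zzΘ = D(∂₂v₂)(X)[∂_zX]`.** -/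
theorem deriv_deriv_branchValue_height {t : ℝ} (ht : t < 0) (z : ℝ) :
    deriv (deriv fun z' => v t (X t z') 2) z =
      fderiv ℝ (fun y => fderiv ℝ (fun y => v t y 2) y (EuclideanSpace.single 2 1)) (X t z) (deriv (X t) z) := by
  have h1 : deriv (fun z' => v t (X t z') 2) = fun z' => fderiv ℝ (fun y => v t y 2) (X t z') (EuclideanSpace.single 2 1) :=
    funext fun z' => (hasDerivAt_branchValue_height hrate hcont hmild hdiv hX2 hXC hcrit ht z').deriv
  rw [h1]
  -- `G(y) := ∂₂v₂(t,y)` is `C¹`; chain rule along `z ↦ X(t,z)`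
  have hV : ContDiff ℝ 2 (fun y => v t y 2) := by
    have h : ContDiff ℝ 2 (v t) :=
      ((isTypeIAncientMild_of_class hrate hcont hmild hdiv).contDiff_slice ht).of_le (by norm_cast)
    exact (EuclideanSpace.proj (𝕜 := ℝ) (2 : Fin 3)).contDiff.comp h
  have hG : ContDiff ℝ 1 (fun y => fderiv ℝ (fun y => v t y 2) y (EuclideanSpace.single 2 1)) :=
    (hV.fderiv_right (m := 1) le_rfl).clm_apply contDiff_const
  have hGd : DifferentiableAt ℝ (fun y => fderiv ℝ (fun y => v t y 2) y (EuclideanSpace.single 2 1)) (X t z) :=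
    (hG.differentiable (by norm_num)) _
  obtain ⟨hXz, -⟩ := hasDerivAt_branch_height hX2 hXC ht z
  exact (hGd.hasFDerivAt.comp_hasDerivAt z hXz).deriv

/-- **THE TYPE-I DICTIONARY OF A BRANCH VALUE.**  One constant `K ≥ 0` (per profile) with, for all `t < 0`, `z`:
`(−t)√(−t)·|∂ₜΘ(t,z)| ≤ K`, `(−t)·|∂_zΘ(t,z)| ≤ K`, `(−t)√(−t)·|∂_zzΘ(t,z)| ≤ K·‖∂_zX(t,z)‖` (derivatives in `deriv` currency for
`Θ = fun t z => v t (X t z) 2`). -/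
theorem branchValue_rates :
    ∃ K : ℝ, 0 ≤ K ∧
      (∀ t < 0, ∀ z, (-t) * Real.sqrt (-t) * |deriv (fun s => v s (X s z) 2) t| ≤ K) ∧
      (∀ t < 0, ∀ z, (-t) * |deriv (fun z' => v t (X t z') 2) z| ≤ K) ∧
      (∀ t < 0, ∀ z, (-t) * Real.sqrt (-t) * |deriv (deriv fun z' => v t (X t z') 2) z| ≤ K * ‖deriv (X t) z‖) := by
  obtain ⟨Kt, hKt0, hKt⟩ := exists_deriv_rate_of_class hrate hcont hmild
  obtain ⟨K1, hK10, hK1⟩ := exists_fderiv_rate_of_class' hrate hcont hmild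
  obtain ⟨K2, hK20, hK2⟩ := exists_iteratedFDeriv_two_rate_of_class' hrate hcont hmild
  refine ⟨Kt + K1 + K2, by positivity, ?_, ?_, ?_⟩
  · intro t ht z
    have hnt : 0 < -t := neg_pos.2 ht
    have hs : 0 < Real.sqrt (-t) := Real.sqrt_pos.2 hnt
    have hts : 0 < (-t) * Real.sqrt (-t) := mul_pos hnt hs
    rw [(hasDerivAt_branchValue_time hrate hcont hmild hdiv hX2 hXC hcrit ht z).deriv]
    -- `|∂ₜv₂| ≤ ‖∂ₜv‖ ≤ Kt/((−t)√(−t))`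
    have hdt : DifferentiableAt ℝ (fun s => v s (X t z)) t := by
      have hA := (isTypeIAncientMild_of_class hrate hcont hmild hdiv).contDiffOn
      have hd : DifferentiableAt ℝ (uncurry v) (t, X t z) :=
        (hA.differentiableOn (by simp)).differentiableAt (slabE_mem_nhds ht (X t z))
      have h := hd.comp t ((differentiableAt_id (𝕜 := ℝ)).prodMk (differentiableAt_const (X t z)))
      simpa [Function.comp_def] using h
    have hcomp : deriv (fun s => v s (X t z) 2) t = (deriv (fun s => v s (X t z)) t) 2 :=
      (hasDerivAt_apply_two hdt.hasDerivAt).deriv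
    have h1 : |deriv (fun s => v s (X t z) 2) t| ≤ ‖deriv (fun s => v s (X t z)) t‖ := by
      rw [hcomp, ← Real.norm_eq_abs]
      exact PiLp.norm_apply_le _ _
    have h2 := hKt t ht (X t z)
    have htne : (-t) * Real.sqrt (-t) ≠ 0 := hts.ne'
    have ht0 : t ≠ 0 := ht.ne
    calc (-t) * Real.sqrt (-t) * |deriv (fun s => v s (X t z) 2) t| ≤ (-t) * Real.sqrt (-t) * (Kt / ((-t) * Real.sqrt (-t))) :=
          mul_le_mul_of_nonneg_left (h1.trans h2) hts.le
      _ = Kt := by field_simp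
      _ ≤ Kt + K1 + K2 := by linarith
  · intro t ht z
    have hnt : 0 < -t := neg_pos.2 ht
    rw [(hasDerivAt_branchValue_height hrate hcont hmild hdiv hX2 hXC hcrit ht z).deriv]
    -- `|∂₂v₂| ≤ ‖Dv‖ ≤ K1/(−t)`
    have hVd : DifferentiableAt ℝ (v t) (X t z) :=
      (((isTypeIAncientMild_of_class hrate hcont hmild hdiv).contDiff_slice ht).differentiable (by simp)) _
    have hcomp : fderiv ℝ (fun y => v t y 2) (X t z) (EuclideanSpace.single 2 1) = (fderiv ℝ (v t) (X t z) (EuclideanSpace.single 2 1)) 2 := by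
      have h := ((EuclideanSpace.proj (𝕜 := ℝ) (2 : Fin 3)).hasFDerivAt.comp (X t z) hVd.hasFDerivAt).fderiv
      rw [show (fun y => v t y 2) = (EuclideanSpace.proj (𝕜 := ℝ) (2 : Fin 3)) ∘ v t from rfl, h]
      simp
    have he2n : ‖(EuclideanSpace.single 2 (1 : ℝ) : EuclideanSpace ℝ (Fin 3))‖ = 1 := by simp
    have h1 : |fderiv ℝ (fun y => v t y 2) (X t z) (EuclideanSpace.single 2 1)| ≤ ‖fderiv ℝ (v t) (X t z)‖ := by
      rw [hcomp, ← Real.norm_eq_abs]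
      calc ‖(fderiv ℝ (v t) (X t z) (EuclideanSpace.single 2 1)) 2‖ ≤ ‖fderiv ℝ (v t) (X t z) (EuclideanSpace.single 2 1)‖ :=
            PiLp.norm_apply_le _ _
        _ ≤ ‖fderiv ℝ (v t) (X t z)‖ * ‖(EuclideanSpace.single 2 (1 : ℝ) : EuclideanSpace ℝ (Fin 3))‖ := ContinuousLinearMap.le_opNorm _ _
        _ = ‖fderiv ℝ (v t) (X t z)‖ := by rw [he2n, mul_one]
    have h2 := hK1 t ht (X t z)
    have htne : (-t) ≠ 0 := hnt.ne'
    have ht0 : t ≠ 0 := ht.ne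
    calc (-t) * |fderiv ℝ (fun y => v t y 2) (X t z) (EuclideanSpace.single 2 1)| ≤ (-t) * (K1 / (-t)) :=
          mul_le_mul_of_nonneg_left (h1.trans h2) hnt.le
      _ = K1 := by field_simp
      _ ≤ Kt + K1 + K2 := by linarith
  · intro t ht z
    have hnt : 0 < -t := neg_pos.2 ht
    have hs : 0 < Real.sqrt (-t) := Real.sqrt_pos.2 hnt
    have hts : 0 < (-t) * Real.sqrt (-t) := mul_pos hnt hs
    rw [deriv_deriv_branchValue_height hrate hcont hmild hdiv hX2 hXC hcrit ht z]
    set e₂ : EuclideanSpace ℝ (Fin 3) := EuclideanSpace.single 2 (1 : ℝ) with he₂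
    set w : EuclideanSpace ℝ (Fin 3) := deriv (X t) z with hw
    have hV2 : ContDiff ℝ 2 (v t) :=
      ((isTypeIAncientMild_of_class hrate hcont hmild hdiv).contDiff_slice ht).of_le (by norm_cast)
    have hVd : Differentiable ℝ (v t) := hV2.differentiable (by simp)
    -- `D(∂₂v₂)(X)[w] = (D²v(X)[w,e₂])₂`
    have hproj : (fun y => fderiv ℝ (fun y => v t y 2) y e₂) = fun y => (fderiv ℝ (v t) y e₂) 2 := by
      funext y
      have h := ((EuclideanSpace.proj (𝕜 := ℝ) (2 : Fin 3)).hasFDerivAt.comp y (hVd y).hasFDerivAt).fderiv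
      rw [show (fun y => v t y 2) = (EuclideanSpace.proj (𝕜 := ℝ) (2 : Fin 3)) ∘ v t from rfl, h]
      simp
    have hGd : DifferentiableAt ℝ (fun y => fderiv ℝ (v t) y e₂) (X t z) :=
      (((hV2.fderiv_right (m := 1) le_rfl).clm_apply contDiff_const).differentiable (by norm_num)) _
    have hcomp : fderiv ℝ (fun y => fderiv ℝ (fun y => v t y 2) y e₂) (X t z) w = (fderiv ℝ (fun y => fderiv ℝ (v t) y e₂) (X t z) w) 2 := by
      rw [hproj]
      have h := ((EuclideanSpace.proj (𝕜 := ℝ) (2 : Fin 3)).hasFDerivAt.comp (X t z) hGd.hasFDerivAt).fderiv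
      rw [show (fun y => (fderiv ℝ (v t) y e₂) 2) = (EuclideanSpace.proj (𝕜 := ℝ) (2 : Fin 3)) ∘ (fun y => fderiv ℝ (v t) y e₂) from rfl, h]
      simp
    have h1 : |fderiv ℝ (fun y => fderiv ℝ (fun y => v t y 2) y e₂) (X t z) w| ≤ ‖iteratedFDeriv ℝ 2 (v t) (X t z)‖ * ‖w‖ := by
      rw [hcomp, ← Real.norm_eq_abs, fderiv_fderiv_apply_eq_iteratedFDeriv_two hV2]
      calc ‖(iteratedFDeriv ℝ 2 (v t) (X t z) ![w, e₂]) 2‖ ≤ ‖iteratedFDeriv ℝ 2 (v t) (X t z) ![w, e₂]‖ := PiLp.norm_apply_le _ _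
        _ ≤ ‖iteratedFDeriv ℝ 2 (v t) (X t z)‖ * ∏ i, ‖(![w, e₂] : Fin 2 → EuclideanSpace ℝ (Fin 3)) i‖ :=
            ContinuousMultilinearMap.le_opNorm _ _
        _ = ‖iteratedFDeriv ℝ 2 (v t) (X t z)‖ * ‖w‖ := by
            rw [Fin.prod_univ_two]
            simp [he₂]
    have h2 := hK2 t ht (X t z)
    have hw0 : 0 ≤ ‖w‖ := norm_nonneg _
    have htne : (-t) * Real.sqrt (-t) ≠ 0 := hts.ne'
    have ht0 : t ≠ 0 := ht.ne
    calc (-t) * Real.sqrt (-t) * |fderiv ℝ (fun y => fderiv ℝ (fun y => v t y 2) y e₂) (X t z) w|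
        ≤ (-t) * Real.sqrt (-t) * (K2 / ((-t) * Real.sqrt (-t)) * ‖w‖) :=
          mul_le_mul_of_nonneg_left (h1.trans (mul_le_mul_of_nonneg_right h2 hw0)) hts.le
      _ = K2 * ‖w‖ := by field_simp
      _ ≤ (Kt + K1 + K2) * ‖w‖ := by nlinarith

end Class

end Summit.NavierStokesRegularity.NavierStokesRegularity.Theorems.PoloidalWindowDoorLrcModEntireTwistingTHBranchValues
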